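import Summits.CriticalPhenomena.PercolationContinuityZ3.Theorems.Transplant.KNCells2ChainBandRO
import Summits.CriticalPhenomena.PercolationContinuityZ3.Theorems.Transplant.SkelPhiRootRun
import HarnessLib

/-!
# (R) under D″, planar instance over the ROOTED admissibility: `RootRun2.RootBandOKR` (= `RootBandOK` with `Band.BandOKR` in place of
# `Band.BandOK`, i.e. without the idle backward-room field `hρ0` — lane INBOX 2026-08-21 ≈08:05Z), the root band schedule
# `RootRun2.rootSchedRO := Band.scheduleRO …` (`KNCells2ChainBandRO`), its `rfl` API and the FIVE planar facts the schedule-generic (R) assembly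
# `Skelφ.rootOblT_concSG_sched` (`SkelPhiRootSchedAssembly`) asks of a root schedule: regions in `BtwN 0 du ∪ Q (0+du)`, off `Q 0`, last core
# in `M (0+du)`, start core = the landing ROW, cores in the root region; plus `RootBandOK.toRootBandOKR` — pure `Site 2` geometry (twin of
# `SkelPhiRootRun` §1)

builds on p205010 (kernel theorem, internal audit signed; external expert review pending) — nothing in this file uses p205010.
Lane `prim-bschramm-*`, seat `prim-bschramm-p2` (gen 8); helper file (`--supports stmt-CriticalPhenomena-4575 --as helper`).
* `RootRun2.RootBandOKR`, `RootBandOK.toRootBandOKR`, **`RootRun2.rootSchedRO`**, `rootSchedRO_region/_core/_ax/_Wb/_params/_N/_R'/_core_zero/_core_last`,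
  **`rootSchedRO_region_subset`**, **`rootSchedRO_region_disjoint_Q`**, **`rootSchedRO_core_last_subset_M`**, `rootSchedRO_core_subset`.
[cite: KozmaNitzan2024, §4 p. 26 (E_{v,x}, M_v), p. 28 ((32) at the root), Lemma 11 (pp. 22–23)]
-/

noncomputable section

namespace Summit.CriticalPhenomena.PercolationContinuityZ3.Theorems

namespace Transplant

/-! ## The rooted band run about the root centre, rooted admissibility -/

namespace RootRun2

open Literature.Probability.Percolation Literature.Probability.LatticeModels
open Literature.Probability.Percolation.KozmaNitzan
open Literature.Probability.Percolation.KozmaNitzan.Cells (oth oth_ne eq_oth_of_ne sgOf sgOf_sign stepVec_apply_fst stepVec_apply_oth)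
open ChainPlanar
open BoxProdZ2 (rootCtr rootCtr_fst rootCtr_oth)

/-- **Admissible parameters of the root BAND run in direction `du`, rooted admissibility** (start row `q = 0` at level `ca`, transverse
centre `cb`, half-width `q'`; `N + 1` band steps of spacing `s₁`; region half-width `ρ`): `Band.BandOKR` (no idle `hρ0`) and the placement of the run above the wired root cube,
inside the narrow between-box, with the far line core inside `M (0 + du)` — measured in the run-axis unit `r∥ = P.r du.1` and the transverse
unit `r⊥ = P.r (oth du.1)`. [this work] -/
structure RootBandOKR (P : PCells2) (du : MDir) (s₁ R' ℓ₀ N WM : ℕ) (Wb : ℕ → ℕ) (ca cb q' ρ : ℤ) : Prop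
    extends Band.BandOKR 0 q' (s₁ : ℤ) ρ R' ℓ₀ N WM Wb where
  /-- region `0` stays above the wired root cube: `5 r∥ + 1 ≤ ca − ρ₀`, `ρ₀ = s₁ + 2R'` -/
  hlo : 5 * (P.r du.1 : ℤ) + 1 + Adv.ρ₀ 0 (s₁ : ℤ) R' ≤ ca
  /-- the run stays inside the child's cube: `ca + (N+1) s₁ ≤ 25 r∥` -/
  hhi : ca + ((N : ℤ) + 1) * s₁ ≤ 25 * (P.r du.1 : ℤ)
  /-- the regions stay inside the narrow between-box transversally -/
  htr : |cb| + ρ ≤ 5 * (P.r (oth du.1) : ℤ) - 1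
  /-- the far line core reaches `M (0 + du)`: `17 r∥ ≤ ca + (N+1) s₁` -/
  hloM : 17 * (P.r du.1 : ℤ) ≤ ca + ((N : ℤ) + 1) * s₁
  /-- the far line core stays inside `M (0 + du)`: `ca + (N+1) s₁ ≤ 23 r∥` -/
  hhiM : ca + ((N : ℤ) + 1) * s₁ ≤ 23 * (P.r du.1 : ℤ)
  /-- the far line core stays inside `M (0 + du)` transversally -/
  htrM : |cb| + Band.w₁ q' R' WM + (N : ℤ) * R' ≤ 3 * (P.r (oth du.1) : ℤ)

variable {P : PCells2} {du : MDir} {s₁ R' ℓ₀ N WM : ℕ} {Wb : ℕ → ℕ} {ca cb q' ρ : ℤ}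

/-- **The root band run as a planar schedule, rooted admissibility**: `Band.scheduleRO` along `du.1` with sign `sgOf du` about the root
centre `rootCtr du ca cb`, start row `q = 0`, extents `≤ s₁ + R'`. [cite: KozmaNitzan2024, §4 Lemma 11 (pp. 22–23), p. 28] -/
def rootSchedRO (P : PCells2) (du : MDir) (h : RootBandOKR P du s₁ R' ℓ₀ N WM Wb ca cb q' ρ) : Schedule :=
  Band.scheduleRO (sgOf_sign du) (rootCtr du ca cb) du.1 h.toBandOKR (two_mul_zero_add_le (s₁ := s₁) (R' := R'))

variable (h : RootBandOKR P du s₁ R' ℓ₀ N WM Wb ca cb q' ρ)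

/-- The regions of the rooted-admissibility root schedule are the rooted band regions. [folklore] -/
@[simp] theorem rootSchedRO_region : (rootSchedRO P du h).region = Band.regionR 0 (s₁ : ℤ) ρ R' du.1 (sgOf du) (rootCtr du ca cb) := rfl

/-- The cores of the rooted-admissibility root schedule are the band cores. [folklore] -/
@[simp] theorem rootSchedRO_core (k : ℕ) : (rootSchedRO P du h).core k = Band.core 0 q' (s₁ : ℤ) R' WM du.1 (sgOf du) (rootCtr du ca cb) k := rfl

/-- The axis of the rooted-admissibility root schedule. [folklore] -/
@[simp] theorem rootSchedRO_ax (k : ℕ) : (rootSchedRO P du h).ax k = du.1 := rfl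

/-- The band spread of the rooted-admissibility root schedule. [folklore] -/
@[simp] theorem rootSchedRO_Wb (k : ℕ) : (rootSchedRO P du h).Wb k = Wb := rfl

/-- The parameters of the rooted-admissibility root schedule. [folklore] -/
theorem rootSchedRO_params : (rootSchedRO P du h).N = N ∧ (rootSchedRO P du h).R' = R' ∧ (rootSchedRO P du h).ℓ₀ = ℓ₀ ∧
    (rootSchedRO P du h).ℓ₁ = s₁ + R' ∧
    (rootSchedRO P du h).prism = sBox du.1 (sgOf du) (rootCtr du ca cb) (-(Adv.ρ₀ 0 (s₁ : ℤ) R')) (0 + ((N : ℤ) + 1) * s₁) ρ :=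
  ⟨rfl, rfl, rfl, rfl, rfl⟩

/-- The number of steps of the rooted-admissibility root schedule. [folklore] -/
@[simp] theorem rootSchedRO_N : (rootSchedRO P du h).N = N := rfl

/-- The neighbourhood radius of the rooted-admissibility root schedule. [folklore] -/
@[simp] theorem rootSchedRO_R' : (rootSchedRO P du h).R' = R' := rfl

/-- **The start core of the rooted-admissibility root schedule is the landing row** `{level = ca, |trans − cb| ≤ q'}`. [folklore] -/
theorem rootSchedRO_core_zero : (rootSchedRO P du h).core 0 = sBox du.1 (sgOf du) (rootCtr du ca cb) (-0) 0 q' :=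
  Band.scheduleRO_core_zero (sgOf_sign du) (rootCtr du ca cb) du.1 h.toBandOKR (two_mul_zero_add_le (s₁ := s₁) (R' := R'))

/-- **The last core of the rooted-admissibility root schedule is the far line core.** [folklore] -/
theorem rootSchedRO_core_last : (rootSchedRO P du h).core (N + 1) =
    sBox du.1 (sgOf du) (rootCtr du ca cb) (0 + ((N : ℤ) + 1) * s₁) (0 + ((N : ℤ) + 1) * s₁) (Band.w₁ q' R' WM + (N : ℤ) * R') :=
  Band.scheduleRO_core_last (sgOf_sign du) (rootCtr du ca cb) du.1 h.toBandOKR (two_mul_zero_add_le (s₁ := s₁) (R' := R'))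

include h in
/-- **Every region of the root band run lies in `BtwN 0 du ∪ Q (0 + du)`** (`k ≤ N`). [cite: KozmaNitzan2024, §4 p. 26 (E_{v,x}), Lemma 11 (p. 22: Ω)] -/
theorem rootSchedRO_region_subset {k : ℕ} (hk : k ≤ N) : (rootSchedRO P du h).region k ⊆ P.BtwN 0 du ∪ P.Q ((0 : Site 2) + stepVec du) := by
  rw [rootSchedRO_region]
  refine (Band.regionR_subset_prismRO (sgOf_sign du) (rootCtr du ca cb) h.toBandOKR hk).trans ?_
  have hlo := h.hlo; have hhi := h.hhi
  exact sBox_rootCtr_subset_BtwN_union_Q P du ca cb (by linarith) (by linarith) h.htr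

include h in
/-- **Every region of the root band run is off the root cube `Q 0`** (`k ≤ N`). [cite: KozmaNitzan2024, §4 p. 28] -/
theorem rootSchedRO_region_disjoint_Q {k : ℕ} (hk : k ≤ N) : Disjoint ((rootSchedRO P du h).region k) (P.Q 0) := by
  rw [rootSchedRO_region]
  refine Finset.disjoint_of_subset_left (Band.regionR_subset_prismRO (sgOf_sign du) (rootCtr du ca cb) h.toBandOKR hk) ?_
  have hlo := h.hlo
  exact sBox_rootCtr_disjoint_Q_zero P du ca cb (hi := 0 + ((N : ℤ) + 1) * s₁) (w := ρ) (by linarith)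

include h in
/-- **The far line core of the root band run lies in `M (0 + du)`.** [cite: KozmaNitzan2024, §4 p. 26 (M_v)] -/
theorem rootSchedRO_core_last_subset_M : (rootSchedRO P du h).core (N + 1) ⊆ P.M ((0 : Site 2) + stepVec du) := by
  rw [rootSchedRO_core_last]
  have hloM := h.hloM; have hhiM := h.hhiM; have htrM := h.htrM
  exact sBox_rootCtr_subset_M P du ca cb (by linarith) (by linarith) (by linarith)

include h in
/-- Every core `k ≤ N + 1` of the root band run lies in `BtwN 0 du ∪ Q (0 + du)` (core `0` through region `0`, core `k + 1` through region `k`).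
[folklore] -/
theorem rootSchedRO_core_subset {k : ℕ} (hk : k ≤ N + 1) : (rootSchedRO P du h).core k ⊆ P.BtwN 0 du ∪ P.Q ((0 : Site 2) + stepVec du) := by
  rcases Nat.eq_zero_or_pos k with rfl | hpos
  · refine subset_trans ?_ (rootSchedRO_region_subset h (k := 0) (Nat.zero_le _))
    have := (rootSchedRO P du h).encl 0 (Nat.zero_le _)
    refine subset_trans ?_ this
    rw [Schedule.core]
    refine Finset.Icc_subset_Icc (fun i => ?_) (fun i => ?_) <;>
      simp only [Pi.sub_apply, Pi.add_apply, Pi.natCast_apply] <;> omega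
  · obtain ⟨k', rfl⟩ : ∃ k', k = k' + 1 := ⟨k - 1, by omega⟩
    exact ((rootSchedRO P du h).core_succ_subset_region (by simp; omega)).trans (rootSchedRO_region_subset h (by omega))

end RootRun2

namespace RootRun2

open Literature.Probability.Percolation Literature.Probability.LatticeModels
open Literature.Probability.Percolation.KozmaNitzan

/-- The full root-run record implies the rooted one. [folklore] -/
theorem RootBandOK.toRootBandOKR {P : PCells2} {du : MDir} {s₁ R' ℓ₀ N WM : ℕ} {Wb : ℕ → ℕ} {ca cb q' ρ : ℤ}
    (h : RootBandOK P du s₁ R' ℓ₀ N WM Wb ca cb q' ρ) : RootBandOKR P du s₁ R' ℓ₀ N WM Wb ca cb q' ρ :=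
  { h.toBandOK.toBandOKR with hlo := h.hlo, hhi := h.hhi, htr := h.htr, hloM := h.hloM, hhiM := h.hhiM, htrM := h.htrM }

end RootRun2

end Transplant

end Summit.CriticalPhenomena.PercolationContinuityZ3.Theorems

end
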